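import Summits.ValiantsHypothesis.ValiantsHypothesis.Theses.BarrierLever
import Summits.ValiantsHypothesis.ValiantsHypothesis.Theorems.BarrierLeverPartitionMinorsHitByVPOfLowerSetsDoors

/-!
# Skeleton line `anchored-peeling` for crux `PartitionMinorsHitByVP` (route `BarrierLever`, 𝒟-side door (c), item 19717):
# the ANCHORED EXPONENTIAL DOOR 𝔄_s and peeling (caterpillar / decision-tree / Lefschetz steps) on simplicial-complex pairs

Lane of prover val-np-p1 (g12 → g14; memo `HOME/val-np-p1/g14/ANCHORED-MEMO-valnp1-g14.md`), registered by planner p1 g19 under D-0145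
(director-valiant g8 20:31:12Z, third line duty). Companion of the registered line `hidden_states` (door of record, Q*(h³) / K ≥ h² sharp).

THE MECHANISM. (1) LOWER-SET REDUCTION (val-np-p1 g12, LANDED: `DownCompression.partitionMinorsHitByVP_of_lowerSets`): item 19717 is
equivalent to its restriction to injective layouts whose row family AND column family are simplicial complexes (lower sets). (2) THE
ANCHORED DOOR 𝔄_s (memo §2; 𝔄₂ = anchor profiles (1,1),(1,2),(2,1)): the generic product over anchors `α = (A | B)` (`1 ≤ |A|,|B| ≤ s`) of
`1 + θ_α x^A y^B ∏_{b∉A}(1 + φ_{αb} x_b) ∏_{d∉B}(1 + ψ_{αd} y_d)` — `O(h^{2s})` anchors × `O(h)` operations, polynomial for FIXED s, in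
`SmallCircuits ℂ (h+h) b(s)` after truncation to degree `2h` (the `AdditiveDoor.truncation_spec` / `ExactCoverDoor` pattern). Its log has
exponentially many monomials per anchor, so the Reed–Solomon no-go for poly BRICK menus (memo §1, `not_exactCoverHypothesis`) does NOT apply.
(3) PEELING: the CATERPILLAR LEMMA (memo §3, proved on paper; one-parameter λ-scalings of anchored parameters make the top λ-coefficient of the
partition minor block-triangular with diagonal blocks = minors of strictly smaller lower pairs: `H(R,C) ⇐ H(Σ₀, dl_c C) ∧ ⋀ H(Λ_i, G_i)`
whenever a bi-peeling step exists), decision-tree steps (§3.2 Rem. 2, door 𝔄_s for trees of depth s−1), and LEFSCHETZ steps at unequal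
splits (§4: cube `2^[2k]` vs Hamming ball `B(2k+1,k)` at every k by hard-Lefschetz defect transfer, kernel files …CubeBallRows / …CubeBall).
DATA: (BP) = «a caterpillar step exists» holds for all type pairs at h ≤ 5 (10/10, 64/64, 2 112/2 112 ⇒ THEOREM: 𝔄₂ hits every layout at
h ≤ 5) and 400/400 random pairs at h = 6; (BP) FAILS on cube8/ball9 (h = 9) — which 𝔄₂ nevertheless hits (rank 256/256; Lefschetz step).

THE LINE (stubs → crux; composition `PartitionMinorsHitByVP_of` kernel-checked through the landed lower-set reduction):
* `stub_anchoredDoor` — for every fixed `s` the anchored door is small: `AnchoredHit s h r u w → ∃ f ∈ SmallCircuits ℂ (h+h) b(s)` with the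
  same nonzero minor (truncation + operation count; routine, size L; `b(s) = 2s + 4` crudely suffices from `h ≥ 2`).
* `stub_anchoredUniversal` — THE CONTENT: for some fixed `s` (conjecturally `s = 2`) and all large `h`, the generic member of 𝔄_s hits EVERY
  injective lower pair `(u, w)` (`AnchoredHit s h r u w`: some parameter values give a nonzero partition minor). Intended proof = induction on
  lower pairs by caterpillar / decision-tree steps (each step needs anchors with `|B| ≤ 1 + depth`) + Lefschetz steps, and «one of them always
  applies» (memo §5) — the caterpillar lemma, the step-existence statement and the Lefschetz step are the SUB-STUBS of this node, to be
  registered on v2 of this skeleton once val-np-p1 supplies the bi-peeling data types (director 20:31:12Z: one exchange).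
* `PartitionMinorsHitByVP_of : Stmt.stub_anchoredDoor → Stmt.stub_anchoredUniversal → PartitionMinorsHitByVP` — proved.

WHY IT MIGHT FAIL. `stub_anchoredUniversal` with s = 2: pairs needing facet-vs-facet peels or deep trees (§3.2 Rem. 1–2, §3.4) may escape 𝔄₂
and force s to grow with h (then the door is not polynomial) — the cube-vs-ball family is the test case (hit by 𝔄₂ at k = 4 via Lefschetz, natural
tree proof needs 𝔄_k). CHEAPEST FALSIFIER: exact rank of ONE random 𝔄₂ instance on the (BP)-free pairs at h = 6..9 (kit; `door_a2.py`), and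
the bounded-depth tree census of §3.5.

Planner valiant-natproofs-p1 g19, 2026-08-27. bears_on: V4 (𝒟-side door (c); nothing on 14610 / VP ≠ VNP). Owner: val-np-p1 lineage (g14 →).
-/

set_option linter.dupNamespace false

namespace Summit.ValiantsHypothesis.ValiantsHypothesis.Cruxes.PartitionMinorsHitByVP.AnchoredPeeling

open Finset MvPolynomial
open Literature.Barriers.ValiantsHypothesis (SmallCircuits)
open Summit.ValiantsHypothesis.ValiantsHypothesis.Theses.BarrierLever (PartitionMinorsHitByVP)
open Summit.ValiantsHypothesis.ValiantsHypothesis.Theorems.BarrierLever (DownCompression.partitionMinorsHitByVP_of_lowerSets)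

noncomputable section

variable {h : ℕ}

/-! ## The anchored door 𝔄_s -/

/-- Anchors of profile `≤ s`: pairs `(A | B)` of nonempty vertex sets with `|A|, |B| ≤ s` (𝔄₂ of the memo uses the profiles
(1,1), (1,2), (2,1); extra anchors only enlarge the generic hit set — specialise their `θ` to 0). -/
abbrev Anchor (s h : ℕ) : Type :=
  {p : Finset (Fin h) × Finset (Fin h) // 1 ≤ p.1.card ∧ p.1.card ≤ s ∧ 1 ≤ p.2.card ∧ p.2.card ≤ s}

/-- The anchored factor `g_α = θ_α · x^A y^B · ∏_{b∉A}(1 + φ_{αb} x_b) · ∏_{d∉B}(1 + ψ_{αd} y_d)` of the anchor `α = (A | B)`. -/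
def anchorFactor (s : ℕ) (θ : Anchor s h → ℂ) (φ ψ : Anchor s h → Fin h → ℂ) (α : Anchor s h) :
    MvPolynomial (Fin (h + h)) ℂ :=
  C (θ α) * (∏ a ∈ α.1.1, X (Fin.castAdd h a)) * (∏ c ∈ α.1.2, X (Fin.natAdd h c)) *
    (∏ b ∈ univ \ α.1.1, (1 + C (φ α b) * X (Fin.castAdd h b))) *
    (∏ d ∈ univ \ α.1.2, (1 + C (ψ α d) * X (Fin.natAdd h d)))

/-- The anchored witness `∏_α (1 + g_α)` (= `exp(Σ_α g_α)` in the zeon algebra, each `g_α² ≡ 0` on multilinear coefficients). -/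
def anchoredWitness (s : ℕ) (θ : Anchor s h → ℂ) (φ ψ : Anchor s h → Fin h → ℂ) : MvPolynomial (Fin (h + h)) ℂ :=
  ∏ α : Anchor s h, (1 + anchorFactor s θ φ ψ α)

/-- `AnchoredHit s h r u w`: SOME member of the anchored family 𝔄_s has a nonzero partition minor on the layout `(u, w)`
(over ℂ this is the memo's `H(R,C)`: the minor is a nonzero polynomial in the parameters). -/
def AnchoredHit (s h r : ℕ) (u w : Fin r → Finset (Fin h)) : Prop :=
  ∃ (θ : Anchor s h → ℂ) (φ ψ : Anchor s h → Fin h → ℂ),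
    (Matrix.of fun i j : Fin r => MvPolynomial.coeff
      (∑ a ∈ u i, Finsupp.single (Fin.castAdd h a) 1 + ∑ c ∈ w j, Finsupp.single (Fin.natAdd h c) 1)
      (anchoredWitness s θ φ ψ)).det ≠ 0

/-! ## Stub statements -/

/-- Stub 1 statement: the anchored door is small for every fixed profile bound `s`. -/
def Stmt.stub_anchoredDoor : Prop :=
  ∀ s : ℕ, ∃ b h₀ : ℕ, ∀ h : ℕ, h₀ ≤ h → ∀ (r : ℕ) (u w : Fin r → Finset (Fin h)),
    AnchoredHit s h r u w →
    ∃ f ∈ SmallCircuits ℂ (h + h) b,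
      (Matrix.of fun i j : Fin r => MvPolynomial.coeff
        (∑ a ∈ u i, Finsupp.single (Fin.castAdd h a) 1 + ∑ c ∈ w j, Finsupp.single (Fin.natAdd h c) 1) f).det ≠ 0

/-- Stub 2 statement: for some fixed `s`, the anchored door hits every injective simplicial-complex pair at all large heights. -/
def Stmt.stub_anchoredUniversal : Prop :=
  ∃ s h₀ : ℕ, ∀ h : ℕ, h₀ ≤ h → ∀ (r : ℕ) (u w : Fin r → Finset (Fin h)),
    Function.Injective u → Function.Injective w →
    IsLowerSet (Set.range u) → IsLowerSet (Set.range w) →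
    AnchoredHit s h r u w

/-! ## Registered stubs -/

/-- **Stub 1 — the anchored door (size).** `|Anchor s h| ≤ h^{2s}`, each factor costs `O(h + s)` operations, truncation to total degree
`≤ 2h` (homogeneous components, `AdditiveDoor.truncation_spec`, ×`(2h+2)²`) keeps every partition-minor coefficient (all of degree ≤ 2h) and
lands in `SmallCircuits ℂ (h+h) (2s+4)` from `h ≥ 2`. Why plausibly true: an operation count (pattern of `ExactCoverDoor.partitionMinor_hit_of_
bricks_mem`, `AdditiveDoor`). Size L. -/
theorem stub_anchoredDoor : Stmt.stub_anchoredDoor := by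
  sorry

/-- **Stub 2 — universality of 𝔄_s on lower pairs (the content; conjecturally s = 2).** Tools: the caterpillar lemma (memo §3, proved on
paper: a bi-peeling step reduces `H(R,C)` to strictly smaller lower pairs at no size cost), decision-tree steps (need `|B| ≤ 1 + depth`),
Lefschetz steps at unequal splits (§4, cube vs Hamming ball ∀k), plus «one of them always applies» (§5, open; (BP) alone fails on cube8/ball9).
Evidence: all type pairs h ≤ 5, 400 random pairs h = 6, cube8/ball9. Why it might fail: pairs forcing the tree depth (hence s) to grow with h. -/
theorem stub_anchoredUniversal : Stmt.stub_anchoredUniversal := by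
  sorry

/-! ## Composition (proved) -/

/-- **The crux from the line**: universality of 𝔄_s on simplicial-complex pairs + the door + the landed lower-set reduction. -/
theorem PartitionMinorsHitByVP_of :
    Stmt.stub_anchoredDoor → Stmt.stub_anchoredUniversal → PartitionMinorsHitByVP := by
  intro hdoor huniv
  obtain ⟨s, h₀, H⟩ := huniv
  obtain ⟨b, h₁, D⟩ := hdoor s
  refine DownCompression.partitionMinorsHitByVP_of_lowerSets ⟨b, max h₀ h₁, fun h hh r u w hu hw hlu hlw => ?_⟩
  exact D h (le_trans (le_max_right _ _) hh) r u w
    (H h (le_trans (le_max_left _ _) hh) r u w hu hw hlu hlw)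

end

end Summit.ValiantsHypothesis.ValiantsHypothesis.Cruxes.PartitionMinorsHitByVP.AnchoredPeeling
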